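import Literature.Probability.RandomPlanarGeometry.SAWPulledLargeForceExpansionZdWordTypesSix
import Literature.Probability.RandomPlanarGeometry.SAWPulledLargeForceExpansionZdFourSlackTwo
import HarnessLib

/-!
# Axis types of length six, II: block sums, raw Boolean zero tests, and the number of axes of a canonical tuple

Topic `Literature/Probability/RandomPlanarGeometry` (continuation of `…ZdWordTypesSix`).  For the fibre censuses one needs, for a
class given by a list of blocks `[i, j)`, the number of canonical types whose block sums are all non-zero, by number of axes.  This
file provides the KERNEL-CHEAP side: raw letters `l0 … l5` of a box tuple, the pairing tests `rv`/`z2`/`z4`/`z6` (Boolean forms of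
the tree lemmas `twoStepV_add_eq_zero_iff`, `ThreeSlackTwo.sum_four_eq_zero_iff`, `FourSlackTwo.sum_six_eq_zero_iff`), the block
sums `bsum` with their type invariance, the class predicates `Good m` / `goodB m` for a MASK `m` on the nine even blocks (for the fibres of «ZD-FOUR-SLACK-TWO» the mask of
a height word `v` is `FourSlackTwo.sameLevel v`) with ★ `goodB_iff`, and `nax` (1 + max axis) with `nax_eq_numAxes` on canonical tuples.
A census cell is the ROBUST nested fold `cnt P k` (`cnt_eq_card`: = the `Finset` count over the canonical box; recursion depth ≤ 72,
one `decide +kernel` per class gives the whole histogram), transported to `Word 6 d` by `card_T6_class`, and ★ `card_good_eq` turns a histogram cell into the census of the class for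
every `d`; worked on class `A6` (six-step SAW words): histogram `2, 388, 2432, 2672, 800, 64` and ★ `card_good_A6` (the `c₆` polynomial).
The definitions `raw`, `l0`…`l5`, `rv`, `z2`, `z4`, `z6`, `blk`, `bsum`, `Good`, `goodR`, `goodB`, `nax`, `lettersF`, `canonR`, `naxR`, `leafR`,
`cnt`, `letters`, `maskA6` are this file's tool notions (not notions in print).  No number is taken from print. [cite: MadrasSlade1993, Definition 1.2.4]

Provenance: lane «pcv-sawmu», a-p3 g18 (2026-08-25).
-/

open Finset
open scoped BigOperators
open Literature.Probability.LatticeModels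
open Literature.Probability.RandomPlanarGeometry.SAW

namespace Literature.Probability.RandomPlanarGeometry.SAW.Zd

namespace WordTypes

/-! ### Raw letters and the pairing tests -/

/-- The raw form of a letter: (axis as a natural, sign). [cite: MadrasSlade1993, Definition 1.2.4] -/
def raw {n : ℕ} (A : Idx n) : ℕ × Bool := (A.1.val, A.2)

/-- `rv a b`: `b` is the reverse of `a` (same axis, opposite sign). [cite: MadrasSlade1993, Definition 1.2.4] -/
def rv (a b : ℕ × Bool) : Bool := a.1 == b.1 && b.2 == !a.2

/-- `rv` on raw letters is `B = revIdx A`. [cite: MadrasSlade1993, Definition 1.2.4] -/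
theorem rv_iff {n : ℕ} (A B : Idx n) : rv (raw A) (raw B) = true ↔ B = revIdx A := by
  obtain ⟨x, s⟩ := A
  obtain ⟨y, s'⟩ := B
  simp only [rv, raw, revIdx, Bool.and_eq_true, beq_iff_eq, Prod.mk.injEq]
  constructor
  · rintro ⟨h1, h2⟩; exact ⟨Fin.ext h1.symm, h2⟩
  · rintro ⟨h1, h2⟩; exact ⟨(congrArg Fin.val h1).symm, h2⟩

/-- Two letters cancel. [cite: MadrasSlade1993, Definition 1.2.4] -/
def z2 (a b : ℕ × Bool) : Bool := rv a b

/-- Four letters cancel in pairs (three matchings). [cite: MadrasSlade1993, Definition 1.2.4] -/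
def z4 (a b c e : ℕ × Bool) : Bool := (rv a b && rv c e) || (rv a c && rv b e) || (rv a e && rv b c)

/-- Six letters cancel in pairs (fifteen matchings, in the order of `FourSlackTwo.sum_six_eq_zero_iff`). [cite: MadrasSlade1993, Definition 1.2.4] -/
def z6 (a b c e f g : ℕ × Bool) : Bool :=
  (rv a b && rv c e && rv f g) || (rv a b && rv c f && rv e g) || (rv a b && rv c g && rv e f) ||
  (rv a c && rv b e && rv f g) || (rv a c && rv b f && rv e g) || (rv a c && rv b g && rv e f) ||
  (rv a e && rv b c && rv f g) || (rv a e && rv b f && rv c g) || (rv a e && rv b g && rv c f) ||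
  (rv a f && rv b c && rv e g) || (rv a f && rv b e && rv c g) || (rv a f && rv b g && rv c e) ||
  (rv a g && rv b c && rv e f) || (rv a g && rv b e && rv c f) || (rv a g && rv b f && rv c e)

/-- `z2` is the vanishing of a two-letter sum. [cite: MadrasSlade1993, Definition 1.2.4] -/
theorem z2_iff {n : ℕ} (A B : Idx n) : z2 (raw A) (raw B) = true ↔ twoStepV n A + twoStepV n B = 0 := by
  rw [z2, rv_iff, twoStepV_add_eq_zero_iff]

/-- `z4` is the vanishing of a four-letter sum. [cite: MadrasSlade1993, §4.2, remark after Theorem 4.2.4 (p. 94)] -/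
theorem z4_iff {n : ℕ} (A B C E : Idx n) :
    z4 (raw A) (raw B) (raw C) (raw E) = true ↔ twoStepV n A + twoStepV n B + twoStepV n C + twoStepV n E = 0 := by
  rw [ThreeSlackTwo.sum_four_eq_zero_iff]
  simp only [z4, Bool.or_eq_true, Bool.and_eq_true, rv_iff, or_assoc]

/-- `z6` is the vanishing of a six-letter sum. [cite: MadrasSlade1993, Definition 1.2.4] -/
theorem z6_iff {n : ℕ} (A B C E F G : Idx n) :
    z6 (raw A) (raw B) (raw C) (raw E) (raw F) (raw G) = true ↔
      twoStepV n A + twoStepV n B + twoStepV n C + twoStepV n E + twoStepV n F + twoStepV n G = 0 := by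
  rw [FourSlackTwo.sum_six_eq_zero_iff]
  simp only [z6, Bool.or_eq_true, Bool.and_eq_true, rv_iff, or_assoc, and_assoc]

/-- The raw letters of a box tuple. [cite: MadrasSlade1993, Definition 1.2.4] -/
def l0 (t : Box6) : ℕ × Bool := (t.1.1.val, t.1.2)
/-- Raw letter 1. [cite: MadrasSlade1993, Definition 1.2.4] -/
def l1 (t : Box6) : ℕ × Bool := (t.2.1.1.val, t.2.1.2)
/-- Raw letter 2. [cite: MadrasSlade1993, Definition 1.2.4] -/
def l2 (t : Box6) : ℕ × Bool := (t.2.2.1.1.val, t.2.2.1.2)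
/-- Raw letter 3. [cite: MadrasSlade1993, Definition 1.2.4] -/
def l3 (t : Box6) : ℕ × Bool := (t.2.2.2.1.1.val, t.2.2.2.1.2)
/-- Raw letter 4. [cite: MadrasSlade1993, Definition 1.2.4] -/
def l4 (t : Box6) : ℕ × Bool := (t.2.2.2.2.1.1.val, t.2.2.2.2.1.2)
/-- Raw letter 5. [cite: MadrasSlade1993, Definition 1.2.4] -/
def l5 (t : Box6) : ℕ × Bool := (t.2.2.2.2.2.1.val, t.2.2.2.2.2.2)

/-- The raw letters are the raw forms of the letters of `ofBox6 t`. [cite: MadrasSlade1993, Definition 1.2.4] -/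
theorem raw_ofBox6 (t : Box6) :
    raw (ofBox6 t 0) = l0 t ∧ raw (ofBox6 t 1) = l1 t ∧ raw (ofBox6 t 2) = l2 t ∧ raw (ofBox6 t 3) = l3 t ∧
      raw (ofBox6 t 4) = l4 t ∧ raw (ofBox6 t 5) = l5 t := by
  refine ⟨?_, ?_, ?_, ?_, ?_, ?_⟩ <;> simp [raw, ofBox6, l0, l1, l2, l3, l4, l5]

/-! ### Block sums and their type invariance -/

/-- The block of positions `[i, j)`. [cite: MadrasSlade1993, Definition 1.2.4] -/
def blk (i j : ℕ) : Finset (Fin 6) := Finset.univ.filter fun p => i ≤ p.val ∧ p.val < j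

/-- The block sum of a word of length 6. [cite: MadrasSlade1993, Definition 1.2.4] -/
noncomputable def bsum {n : ℕ} (u : Word 6 n) (i j : ℕ) : Site (n + 1) := ∑ p ∈ blk i j, twoStepV n (u p)

/-- Vanishing of a block sum is a type invariant. [cite: MadrasSlade1993, Definition 1.2.4] -/
theorem bsum_eq_zero_iff_canon {n : ℕ} (u : Word 6 n) (i j : ℕ) : bsum u i j = 0 ↔ bsum (canon u) i j = 0 :=
  (sameType_canon u).sum_eq_zero_iff _

/-- A CLASS is a mask on the nine even blocks `(0,2) (1,3) (2,4) (3,5) (4,6) (0,4) (1,5) (2,6) (0,6)`: which block sums must be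
non-zero (for the fibres of «ZD-FOUR-SLACK-TWO», the mask of a height word `v` is `FourSlackTwo.sameLevel v`). [cite: MadrasSlade1993, Definition 1.2.4] -/
def Good {n : ℕ} (m : ℕ → ℕ → Bool) (u : Word 6 n) : Prop :=
  (m 0 2 = true → bsum u 0 2 ≠ 0) ∧ (m 1 3 = true → bsum u 1 3 ≠ 0) ∧ (m 2 4 = true → bsum u 2 4 ≠ 0) ∧
    (m 3 5 = true → bsum u 3 5 ≠ 0) ∧ (m 4 6 = true → bsum u 4 6 ≠ 0) ∧ (m 0 4 = true → bsum u 0 4 ≠ 0) ∧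
    (m 1 5 = true → bsum u 1 5 ≠ 0) ∧ (m 2 6 = true → bsum u 2 6 ≠ 0) ∧ (m 0 6 = true → bsum u 0 6 ≠ 0)

/-- `Good m` is decidable. [cite: MadrasSlade1993, Definition 1.2.4] -/
noncomputable instance {n : ℕ} (m : ℕ → ℕ → Bool) : DecidablePred (Good (n := n) m) := fun u => by
  unfold Good; infer_instance

/-- `Good m` is a type invariant. [cite: MadrasSlade1993, Definition 1.2.4] -/
theorem good_iff_canon {n : ℕ} (m : ℕ → ℕ → Bool) (u : Word 6 n) : Good m u ↔ Good m (canon u) := by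
  unfold Good
  simp only [ne_eq, bsum_eq_zero_iff_canon u]

/-- The raw class test on six raw letters (no dispatch: nine fixed pairing tests gated by the mask). [cite: MadrasSlade1993, Definition 1.2.4] -/
def goodR (m : ℕ → ℕ → Bool) (a b c e f g : ℕ × Bool) : Bool :=
  (!m 0 2 || !z2 a b) && (!m 1 3 || !z2 b c) && (!m 2 4 || !z2 c e) && (!m 3 5 || !z2 e f) && (!m 4 6 || !z2 f g) &&
    (!m 0 4 || !z4 a b c e) && (!m 1 5 || !z4 b c e f) && (!m 2 6 || !z4 c e f g) && (!m 0 6 || !z6 a b c e f g)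

/-- The raw class test of a box tuple. [cite: MadrasSlade1993, Definition 1.2.4] -/
def goodB (m : ℕ → ℕ → Bool) (t : Box6) : Bool := goodR m (l0 t) (l1 t) (l2 t) (l3 t) (l4 t) (l5 t)

/-- One gated conjunct: `(!μ || !z) = true ↔ (μ = true → ¬ Z)` when `z = true ↔ Z`. [cite: MadrasSlade1993, Definition 1.2.4] -/
theorem gate_iff (μ z : Bool) (Z : Prop) (h : z = true ↔ Z) : (!μ || !z) = true ↔ (μ = true → ¬ Z) := by
  rw [← h]; cases μ <;> cases z <;> simp

/-- ★ The raw class test is the class predicate of the word. [cite: MadrasSlade1993, Definition 1.2.4] -/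
theorem goodB_iff (m : ℕ → ℕ → Bool) (t : Box6) : goodB m t = true ↔ Good m (ofBox6 t) := by
  obtain ⟨r0, r1, r2, r3, r4, r5⟩ := raw_ofBox6 t
  have b02 : blk 0 2 = {0, 1} := by decide
  have b13 : blk 1 3 = {1, 2} := by decide
  have b24 : blk 2 4 = {2, 3} := by decide
  have b35 : blk 3 5 = {3, 4} := by decide
  have b46 : blk 4 6 = {4, 5} := by decide
  have b04 : blk 0 4 = {0, 1, 2, 3} := by decide
  have b15 : blk 1 5 = {1, 2, 3, 4} := by decide
  have b26 : blk 2 6 = {2, 3, 4, 5} := by decide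
  have b06 : blk 0 6 = {0, 1, 2, 3, 4, 5} := by decide
  -- each raw test ↔ vanishing of the corresponding block sum
  have e02 : z2 (l0 t) (l1 t) = true ↔ bsum (ofBox6 t) 0 2 = 0 := by
    rw [← r0, ← r1, z2_iff, bsum, b02, Finset.sum_pair (by decide)]
  have e13 : z2 (l1 t) (l2 t) = true ↔ bsum (ofBox6 t) 1 3 = 0 := by
    rw [← r1, ← r2, z2_iff, bsum, b13, Finset.sum_pair (by decide)]
  have e24 : z2 (l2 t) (l3 t) = true ↔ bsum (ofBox6 t) 2 4 = 0 := by
    rw [← r2, ← r3, z2_iff, bsum, b24, Finset.sum_pair (by decide)]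
  have e35 : z2 (l3 t) (l4 t) = true ↔ bsum (ofBox6 t) 3 5 = 0 := by
    rw [← r3, ← r4, z2_iff, bsum, b35, Finset.sum_pair (by decide)]
  have e46 : z2 (l4 t) (l5 t) = true ↔ bsum (ofBox6 t) 4 6 = 0 := by
    rw [← r4, ← r5, z2_iff, bsum, b46, Finset.sum_pair (by decide)]
  have e04 : z4 (l0 t) (l1 t) (l2 t) (l3 t) = true ↔ bsum (ofBox6 t) 0 4 = 0 := by
    rw [← r0, ← r1, ← r2, ← r3, z4_iff, bsum, b04, Finset.sum_insert (by decide), Finset.sum_insert (by decide),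
      Finset.sum_pair (by decide)]
    constructor <;> intro h <;> rw [← h] <;> abel
  have e15 : z4 (l1 t) (l2 t) (l3 t) (l4 t) = true ↔ bsum (ofBox6 t) 1 5 = 0 := by
    rw [← r1, ← r2, ← r3, ← r4, z4_iff, bsum, b15, Finset.sum_insert (by decide), Finset.sum_insert (by decide),
      Finset.sum_pair (by decide)]
    constructor <;> intro h <;> rw [← h] <;> abel
  have e26 : z4 (l2 t) (l3 t) (l4 t) (l5 t) = true ↔ bsum (ofBox6 t) 2 6 = 0 := by
    rw [← r2, ← r3, ← r4, ← r5, z4_iff, bsum, b26, Finset.sum_insert (by decide), Finset.sum_insert (by decide),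
      Finset.sum_pair (by decide)]
    constructor <;> intro h <;> rw [← h] <;> abel
  have e06 : z6 (l0 t) (l1 t) (l2 t) (l3 t) (l4 t) (l5 t) = true ↔ bsum (ofBox6 t) 0 6 = 0 := by
    rw [← r0, ← r1, ← r2, ← r3, ← r4, ← r5, z6_iff, bsum, b06, Finset.sum_insert (by decide), Finset.sum_insert (by decide),
      Finset.sum_insert (by decide), Finset.sum_insert (by decide), Finset.sum_pair (by decide)]
    constructor <;> intro h <;> rw [← h] <;> abel
  unfold goodB goodR Good
  simp only [Bool.and_eq_true]
  rw [gate_iff _ _ _ e02, gate_iff _ _ _ e13, gate_iff _ _ _ e24, gate_iff _ _ _ e35, gate_iff _ _ _ e46, gate_iff _ _ _ e04,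
    gate_iff _ _ _ e15, gate_iff _ _ _ e26, gate_iff _ _ _ e06]
  simp only [ne_eq, and_assoc]

/-! ### Number of axes of a canonical tuple -/

/-- `1 + max axis` of a box tuple (raw). [cite: MadrasSlade1993, Definition 1.2.4] -/
def nax (t : Box6) : ℕ :=
  (t.1.1.val ⊔ (t.2.1.1.val ⊔ (t.2.2.1.1.val ⊔ (t.2.2.2.1.1.val ⊔ (t.2.2.2.2.1.1.val ⊔ t.2.2.2.2.2.1.val))))) + 1

/-- For an axis-fixed word, the ranks of the first occurrences are exactly `0, …, numAxes − 1`; hence `numAxes = 1 + max axis`.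
[cite: MadrasSlade1993, Definition 1.2.4] -/
theorem numAxes_eq_sup_succ {L d : ℕ} (u : Word L d) (h : AxFixed u) (hL : 0 < L) :
    numAxes u = (Finset.univ.sup fun p : Fin L => (u p).1.val) + 1 := by
  classical
  -- every rank is < numAxes, and numAxes - 1 is attained by a first occurrence
  have hlt : ∀ p : Fin L, (u p).1.val < numAxes u := by
    intro p
    rw [h p, rank_eq_nf]
    · unfold nf numAxes
      apply Finset.card_lt_card
      refine (Finset.ssubset_iff_of_subset (Finset.filter_subset _ _)).2 ⟨firstOcc u p, ?_, ?_⟩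
      · exact Finset.mem_filter.2 ⟨Finset.mem_univ _, isFirst_firstOcc u p⟩
      · rw [Finset.mem_filter]; exact fun hh => lt_irrefl _ hh.2
  have hpos : 0 < numAxes u := lt_of_le_of_lt (Nat.zero_le _) (hlt ⟨0, hL⟩)
  apply le_antisymm
  · -- numAxes - 1 is a rank of some first occurrence: use `exists_first_of_lt_nf` at the last position? Use injectivity count instead:
    -- the image of `fun p => (u p).1.val` over univ contains `numAxes` distinct values all `< numAxes`, so it is `range numAxes`.
    have himg : (Finset.univ.image fun p : Fin L => (u p).1.val) = Finset.range (numAxes u) := by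
      apply Finset.eq_of_subset_of_card_le
      · intro v hv
        obtain ⟨p, -, rfl⟩ := Finset.mem_image.1 hv
        exact Finset.mem_range.2 (hlt p)
      · rw [Finset.card_range]
        -- card of image ≥ numAxes: the first occurrences have distinct axes
        have : (firsts u).card ≤ (Finset.univ.image fun p : Fin L => (u p).1.val).card := by
          rw [← Finset.card_image_of_injOn (s := firsts u) (f := fun p : Fin L => (u p).1.val) ?_]
          · exact Finset.card_le_card (Finset.image_subset_image (Finset.subset_univ _))
          · intro p hp q hq hpq
            exact (Finset.mem_filter.1 hp).2.eq_of_axis_eq (Finset.mem_filter.1 hq).2 (Fin.ext hpq)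
        exact this
    have hmem : numAxes u - 1 ∈ Finset.univ.image fun p : Fin L => (u p).1.val := by
      rw [himg]; exact Finset.mem_range.2 (Nat.sub_lt hpos Nat.one_pos)
    obtain ⟨p, -, hp⟩ := Finset.mem_image.1 hmem
    have := Finset.le_sup (f := fun p : Fin L => (u p).1.val) (Finset.mem_univ p)
    simp only [hp] at this
    omega
  · have : (Finset.univ.sup fun p : Fin L => (u p).1.val) < numAxes u := by
      apply (Finset.sup_lt_iff hpos).2
      intro p _
      exact hlt p
    omega

/-- ★ On canonical tuples, the raw `nax` is the number of axes of the word. [cite: MadrasSlade1993, Definition 1.2.4] -/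
theorem nax_eq_numAxes (t : Box6) (ht : t ∈ boxT6) : nax t = numAxes (ofBox6 t) := by
  have hfix : AxFixed (ofBox6 t) := ((mem_boxT6 t).1 ht).axFixed
  rw [numAxes_eq_sup_succ _ hfix (by norm_num), nax]
  have e : (Finset.univ : Finset (Fin 6)) = {0, 1, 2, 3, 4, 5} := by decide
  rw [e]
  simp only [Finset.sup_insert, Finset.sup_singleton]
  simp [ofBox6]

/-! ### Census cells in ROBUST form: nested `List.foldr` over the letters (shallow kernel recursion)

A `decide +kernel` over `Finset.univ.filter` on the 46 080-tuple box recurses as deep as the flattened list and fails on farm nodes with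
a small native stack; the nested fold below has recursion depth ≤ 6 · 12 and the same leaf cost.  `cnt_eq_card` identifies it with the
`Finset` count once and for all. -/

/-- The letters of axis `< n`, as a duplicate-free list. [cite: MadrasSlade1993, Definition 1.2.4] -/
def lettersF (n : ℕ) : List (Fin n × Bool) := (List.finRange n).flatMap fun i => [(i, true), (i, false)]

/-- The RAW letters of axis `< n`: `(axis, sign)` as `ℕ × Bool` (what the kernel folds over). [cite: MadrasSlade1993, Definition 1.2.4] -/
def letters (n : ℕ) : List (ℕ × Bool) := (List.range n).flatMap fun a => [(a, true), (a, false)]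

/-- `letters n` is the raw image of `lettersF n` (for the six `n` used). [cite: MadrasSlade1993, Definition 1.2.4] -/
theorem letters_eq_map {n : ℕ} (hn : n ≤ 6) : letters n = (lettersF n).map fun a => (a.1.val, a.2) := by
  interval_cases n <;> decide

/-- Fold-sum: `l.foldr (fun a acc => acc + f a) 0 = (l.map f).sum`. [cite: MadrasSlade1993, Definition 1.2.4] -/
theorem foldr_add_eq_sum {α : Type*} (l : List α) (f : α → ℕ) : l.foldr (fun a acc => acc + f a) 0 = (l.map f).sum := by
  induction l with
  | nil => rfl
  | cons a l ih => simp [List.foldr_cons, ih, Nat.add_comm]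

/-- Summing over `Fin n × Bool` = fold over `lettersF n` (for the six `n` used). [cite: MadrasSlade1993, Definition 1.2.4] -/
theorem sum_eq_foldr_lettersF {n : ℕ} (hn : n ≤ 6) (f : Fin n × Bool → ℕ) :
    ∑ a : Fin n × Bool, f a = (lettersF n).foldr (fun a acc => acc + f a) 0 := by
  rw [foldr_add_eq_sum]
  have hnd : (lettersF n).Nodup := by
    interval_cases n <;> decide
  have huniv : (lettersF n).toFinset = Finset.univ := by
    interval_cases n <;> decide
  rw [← huniv, List.sum_toFinset _ hnd]

/-- Restricted growth on six raw letters (Boolean). [cite: MadrasSlade1993, Definition 1.2.4] -/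
def canonR (a b c e f g : ℕ × Bool) : Bool :=
  (a.1 == 0) && b.1.ble (a.1 + 1) && c.1.ble ((a.1 + 1) ⊔ (b.1 + 1)) && e.1.ble ((a.1 + 1) ⊔ ((b.1 + 1) ⊔ (c.1 + 1))) &&
    f.1.ble ((a.1 + 1) ⊔ ((b.1 + 1) ⊔ ((c.1 + 1) ⊔ (e.1 + 1)))) &&
    g.1.ble ((a.1 + 1) ⊔ ((b.1 + 1) ⊔ ((c.1 + 1) ⊔ ((e.1 + 1) ⊔ (f.1 + 1)))))

/-- `canonR` on the raw letters of a box tuple is `CanonB`. [cite: MadrasSlade1993, Definition 1.2.4] -/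
theorem canonR_iff (t : Box6) : canonR (l0 t) (l1 t) (l2 t) (l3 t) (l4 t) (l5 t) = true ↔ CanonB t := by
  simp only [canonR, CanonB, l0, l1, l2, l3, l4, l5, Bool.and_eq_true, beq_iff_eq, Nat.ble_eq, Nat.le_zero, and_assoc]

/-- `1 + max axis` on six raw letters. [cite: MadrasSlade1993, Definition 1.2.4] -/
def naxR (a b c e f g : ℕ × Bool) : ℕ := (a.1 ⊔ (b.1 ⊔ (c.1 ⊔ (e.1 ⊔ (f.1 ⊔ g.1))))) + 1

/-- The raw leaf test of a census cell. [cite: MadrasSlade1993, Definition 1.2.4] -/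
def leafR (m : ℕ → ℕ → Bool) (k : ℕ) (a b c e f g : ℕ × Bool) : Bool := canonR a b c e f g && goodR m a b c e f g && (naxR a b c e f g == k)

/-- The leaf test decides `CanonB ∧ goodB ∧ nax = k`. [cite: MadrasSlade1993, Definition 1.2.4] -/
theorem leafR_iff (m : ℕ → ℕ → Bool) (k : ℕ) (t : Box6) :
    leafR m k (l0 t) (l1 t) (l2 t) (l3 t) (l4 t) (l5 t) = true ↔ CanonB t ∧ goodB m t = true ∧ nax t = k := by
  rw [leafR, Bool.and_eq_true, Bool.and_eq_true, canonR_iff, beq_iff_eq, and_assoc]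
  exact Iff.rfl

/-- Summing `f ∘ raw` over `Fin n × Bool` = folding `f` over the raw letters. [cite: MadrasSlade1993, Definition 1.2.4] -/
theorem sum_eq_foldr_letters {n : ℕ} (hn : n ≤ 6) (f : ℕ × Bool → ℕ) :
    ∑ a : Fin n × Bool, f (a.1.val, a.2) = (letters n).foldr (fun r acc => acc + f r) 0 := by
  rw [sum_eq_foldr_lettersF hn, letters_eq_map hn, List.foldr_map]

/-- The robust census count: canonical tuples of class `m` with `k` axes, as a nested fold over the letters with a raw Boolean leaf
(recursion depth ≤ 6·12; one kernel pass ≈ seconds). [cite: MadrasSlade1993, Definition 1.2.4] -/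
def cnt (m : ℕ → ℕ → Bool) (k : ℕ) : ℕ :=
  (letters 1).foldr (fun a0 acc0 => acc0 + (letters 2).foldr (fun a1 acc1 => acc1 + (letters 3).foldr (fun a2 acc2 => acc2 +
    (letters 4).foldr (fun a3 acc3 => acc3 + (letters 5).foldr (fun a4 acc4 => acc4 + (letters 6).foldr (fun a5 acc5 => acc5 +
      (if leafR m k a0 a1 a2 a3 a4 a5 = true then 1 else 0)) 0) 0) 0) 0) 0) 0

/-- ★ The fold IS the `Finset` count over the canonical box. [cite: MadrasSlade1993, Definition 1.2.4] -/
theorem cnt_eq_card (m : ℕ → ℕ → Bool) (k : ℕ) :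
    cnt m k = (boxT6.filter fun t => goodB m t = true ∧ nax t = k).card := by
  rw [boxT6, Finset.filter_filter, Finset.card_filter]
  have hleaf : ∀ t : Box6, (if CanonB t ∧ goodB m t = true ∧ nax t = k then 1 else 0) =
      (if leafR m k (t.1.1.val, t.1.2) (t.2.1.1.val, t.2.1.2) (t.2.2.1.1.val, t.2.2.1.2) (t.2.2.2.1.1.val, t.2.2.2.1.2)
        (t.2.2.2.2.1.1.val, t.2.2.2.2.1.2) (t.2.2.2.2.2.1.val, t.2.2.2.2.2.2) = true then 1 else 0) :=
    fun t => if_congr (leafR_iff m k t).symm rfl rfl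
  simp only [hleaf]
  unfold cnt
  rw [Fintype.sum_prod_type, sum_eq_foldr_letters (by norm_num) (fun r0 => ∑ y : (Fin 2 × Bool) × (Fin 3 × Bool) × (Fin 4 × Bool) ×
    (Fin 5 × Bool) × (Fin 6 × Bool), if leafR m k r0 (y.1.1.val, y.1.2) (y.2.1.1.val, y.2.1.2) (y.2.2.1.1.val, y.2.2.1.2)
      (y.2.2.2.1.1.val, y.2.2.2.1.2) (y.2.2.2.2.1.val, y.2.2.2.2.2) = true then 1 else 0)]
  refine congrArg (fun g => (letters 1).foldr g 0) (funext fun r0 => funext fun acc0 => congrArg (acc0 + ·) ?_)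
  rw [Fintype.sum_prod_type, sum_eq_foldr_letters (by norm_num) (fun r1 => ∑ y : (Fin 3 × Bool) × (Fin 4 × Bool) × (Fin 5 × Bool) ×
    (Fin 6 × Bool), if leafR m k r0 r1 (y.1.1.val, y.1.2) (y.2.1.1.val, y.2.1.2) (y.2.2.1.1.val, y.2.2.1.2)
      (y.2.2.2.1.val, y.2.2.2.2) = true then 1 else 0)]
  refine congrArg (fun g => (letters 2).foldr g 0) (funext fun r1 => funext fun acc1 => congrArg (acc1 + ·) ?_)
  rw [Fintype.sum_prod_type, sum_eq_foldr_letters (by norm_num) (fun r2 => ∑ y : (Fin 4 × Bool) × (Fin 5 × Bool) × (Fin 6 × Bool),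
    if leafR m k r0 r1 r2 (y.1.1.val, y.1.2) (y.2.1.1.val, y.2.1.2) (y.2.2.1.val, y.2.2.2) = true then 1 else 0)]
  refine congrArg (fun g => (letters 3).foldr g 0) (funext fun r2 => funext fun acc2 => congrArg (acc2 + ·) ?_)
  rw [Fintype.sum_prod_type, sum_eq_foldr_letters (by norm_num) (fun r3 => ∑ y : (Fin 5 × Bool) × (Fin 6 × Bool),
    if leafR m k r0 r1 r2 r3 (y.1.1.val, y.1.2) (y.2.1.val, y.2.2) = true then 1 else 0)]
  refine congrArg (fun g => (letters 4).foldr g 0) (funext fun r3 => funext fun acc3 => congrArg (acc3 + ·) ?_)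
  rw [Fintype.sum_prod_type, sum_eq_foldr_letters (by norm_num) (fun r4 => ∑ y : Fin 6 × Bool,
    if leafR m k r0 r1 r2 r3 r4 (y.1.val, y.2) = true then 1 else 0)]
  refine congrArg (fun g => (letters 5).foldr g 0) (funext fun r4 => funext fun acc4 => congrArg (acc4 + ·) ?_)
  rw [sum_eq_foldr_letters (by norm_num) (fun r5 => if leafR m k r0 r1 r2 r3 r4 r5 = true then 1 else 0)]

/-- ★ TRANSPORT OF A CELL to `T6` with the genuine `Good`/`numAxes`. [cite: MadrasSlade1993, Definition 1.2.4] -/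
theorem card_T6_class (m : ℕ → ℕ → Bool) (k : ℕ) : ((T6.filter (Good m)).filter fun τ => numAxes τ = k).card = cnt m k := by
  rw [Finset.filter_filter, card_filter_T6, cnt_eq_card]
  refine congrArg Finset.card (Finset.filter_congr fun t ht => ?_)
  rw [goodB_iff m t, nax_eq_numAxes t ht]

/-- ★ THE CENSUS OF A CLASS from its histogram cell: if `cnt m k = n k` for `k ≤ 6` then
`#{u : Word 6 d | Good m u} = Σ_{k ≤ 6} n k · d^{(k)}` for every `d`. [cite: MadrasSlade1993, Definition 1.2.4] -/
theorem card_good_eq (m : ℕ → ℕ → Bool) (d : ℕ) :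
    (Finset.univ.filter fun u : Word 6 d => Good m u).card = ∑ k ∈ Finset.range 7, cnt m k * d.descFactorial k := by
  rw [card_filter_eq_sum_T6 (Good m) (Good m) (good_iff_canon m), sum_ite_descFactorial_numAxes]
  exact Finset.sum_congr rfl fun k _ => by rw [card_T6_class]

/-! ### Worked class `A6` (six-step SAW words): the full histogram by ONE robust kernel cell -/

/-- Class `A6`: every even block (the transverse words of the six-step SAWs). [cite: MadrasSlade1993, Definition 1.2.4] -/
def maskA6 : ℕ → ℕ → Bool := fun _ _ => true

/-- KERNEL CELL `A6`, `k = 0`: 0 canonical types (one cell per `k`: each `decide +kernel` stays within the default budget).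
[cite: MadrasSlade1993, Definition 1.2.4] -/
theorem cnt_A6_zero : cnt maskA6 0 = 0 := by decide +kernel

/-- KERNEL CELL `A6`, `k = 1`: 2 canonical types (one cell per `k`: each `decide +kernel` stays within the default budget).
[cite: MadrasSlade1993, Definition 1.2.4] -/
theorem cnt_A6_one : cnt maskA6 1 = 2 := by decide +kernel

/-- KERNEL CELL `A6`, `k = 2`: 388 canonical types (one cell per `k`: each `decide +kernel` stays within the default budget).
[cite: MadrasSlade1993, Definition 1.2.4] -/
theorem cnt_A6_two : cnt maskA6 2 = 388 := by decide +kernel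

/-- KERNEL CELL `A6`, `k = 3`: 2432 canonical types (one cell per `k`: each `decide +kernel` stays within the default budget).
[cite: MadrasSlade1993, Definition 1.2.4] -/
theorem cnt_A6_three : cnt maskA6 3 = 2432 := by decide +kernel

/-- KERNEL CELL `A6`, `k = 4`: 2672 canonical types (one cell per `k`: each `decide +kernel` stays within the default budget).
[cite: MadrasSlade1993, Definition 1.2.4] -/
theorem cnt_A6_four : cnt maskA6 4 = 2672 := by decide +kernel

/-- KERNEL CELL `A6`, `k = 5`: 800 canonical types (one cell per `k`: each `decide +kernel` stays within the default budget).
[cite: MadrasSlade1993, Definition 1.2.4] -/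
theorem cnt_A6_five : cnt maskA6 5 = 800 := by decide +kernel

/-- KERNEL CELL `A6`, `k = 6`: 64 canonical types (one cell per `k`: each `decide +kernel` stays within the default budget).
[cite: MadrasSlade1993, Definition 1.2.4] -/
theorem cnt_A6_six : cnt maskA6 6 = 64 := by decide +kernel

/-- ★ EXAMPLE OF THE CENSUS: the number of six-letter words over `Idx d` all of whose even block sums are non-zero (= the transverse
words of the six-step SAWs) is `2d + 388d^{(2)} + 2432d^{(3)} + 2672d^{(4)} + 800d^{(5)} + 64d^{(6)}` — the tree's `c₆` polynomial
`64d⁶ − 160d⁵ + 112d⁴ + 20d² − 34d` in falling-factorial form — for every `d`. [cite: MadrasSlade1993, Definition 1.2.4] -/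
theorem card_good_A6 (d : ℕ) :
    (Finset.univ.filter fun u : Word 6 d => Good maskA6 u).card =
      2 * d.descFactorial 1 + 388 * d.descFactorial 2 + 2432 * d.descFactorial 3 + 2672 * d.descFactorial 4 +
        800 * d.descFactorial 5 + 64 * d.descFactorial 6 := by
  rw [card_good_eq]
  simp only [Finset.sum_range_succ, Finset.sum_range_zero, cnt_A6_zero, cnt_A6_one, cnt_A6_two, cnt_A6_three, cnt_A6_four,
    cnt_A6_five, cnt_A6_six]
  ring

end WordTypes

end Literature.Probability.RandomPlanarGeometry.SAW.Zd
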